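import Mathlib
import HarnessLib
import Summits.ValiantsHypothesis.ValiantsHypothesis.Theses.MonotoneRestoration
import Literature.Computability.AlgebraicComplexity.ArithCircuit
import Literature.Computability.AlgebraicComplexity.ArithCircuitProofs
import Literature.Computability.AlgebraicComplexity.MonotoneStructure
import Literature.Computability.AlgebraicComplexity.PermanentIrreducible
import Literature.ModelTheory.FiniteModelTheory.CkEquiv
import Summits.ValiantsHypothesis.ValiantsHypothesis.Theorems.MonotoneRestorationMonotoneRestorationQPCosetCount
import Summits.ValiantsHypothesis.ValiantsHypothesis.Theorems.MonotoneRestorationMonotoneRestorationQPSymmetricLB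
import Summits.ValiantsHypothesis.ValiantsHypothesis.Theorems.MonotoneRestorationMonotoneRestorationQPSupportSymmetrisation
import Summits.ValiantsHypothesis.ValiantsHypothesis.Theorems.MonotoneRestorationMonotoneRestorationQPSparseRegime
import Summits.ValiantsHypothesis.ValiantsHypothesis.Theorems.MonotoneRestorationMonotoneRestorationQPBeta
import Literature.Computability.AlgebraicComplexity.SymmetricArithCircuit
import Literature.Computability.AlgebraicComplexity.DawarWilsenach2025Proofs
import Literature.GroupTheory.PermutationGroups.SmallIndexSubgroups
import Summits.ValiantsHypothesis.ValiantsHypothesis.Theorems.MonotoneRestorationQP.Negative.LoadBearing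
import Summits.ValiantsHypothesis.ValiantsHypothesis.Theorems.MonotoneRestorationMonotoneRestorationQPPermSupportCount
import Summits.ValiantsHypothesis.ValiantsHypothesis.Theorems.MonotoneRestorationMonotoneRestorationQPAltOrbitDichotomy

/-! TTRL-lite variant V14394 of stmt-ValiantsHypothesis-15886 -/

-- `Summit.<Summit>.<Problem>` is the tree's mandated summit-side namespace (CONVENTIONS §2); for this
-- single-conjunct summit the two coincide, so the duplicate is deliberate.
set_option linter.dupNamespace false

namespace Summit.ValiantsHypothesis.ValiantsHypothesis.Theorems

open Summit.ValiantsHypothesis.ValiantsHypothesis.Theses.MonotoneRestoration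
open Literature.Computability.AlgebraicComplexity

/-- **Variant V14394 of `stub_altFixing_orbit_dichotomy` (strengthened hypothesis `q ∈ T`).**  Let
`X ⊆ [n]` with `|X| + 9 ≤ n` and let `A_X` be the even permutations of `[n]` fixing `X` pointwise,
acting on `K[x_{ij}]` by renaming along the diagonal `(i, j) ↦ (ρ i, ρ j)`.  If the `A_X`-orbit of
`q` lies in a finite set `T` with `|T| + |X| < n`, then `q` is `A_X`-fixed.  The extra hypothesis
`q ∈ T` is idle (it already follows from `horb` at `ρ = 1`); the statement is immediate from the
landed general stub `stub_altFixing_orbit_dichotomy` (`A_X ≅ Alt([n] ∖ X)` has no proper subgroup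
of index `< n - |X|` when `n - |X| ≥ 5`, so an orbit of size `< n - |X|` is a point). [folklore] -/
theorem stub_altFixing_orbit_dichotomy_var14394 :
    ∀ (n : ℕ) (K : Type) [CommSemiring K] (q : MvPolynomial (Fin n × Fin n) K)
      (X : Finset (Fin n)) (h8 : X.card + 9 ≤ n) (T : Finset (MvPolynomial (Fin n × Fin n) K))
      (hT : T.card + X.card < n)
      (horb : ∀ ρ : Equiv.Perm (Fin n), (∀ x ∈ X, ρ x = x) → Equiv.Perm.sign ρ = 1 →
        MvPolynomial.rename (fun p : Fin n × Fin n => (ρ p.1, ρ p.2)) q ∈ T)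
      (ρ : Equiv.Perm (Fin n)), q ∈ T → (∀ x ∈ X, ρ x = x) → Equiv.Perm.sign ρ = 1 →
        MvPolynomial.rename (fun p : Fin n × Fin n => (ρ p.1, ρ p.2)) q = q :=
  fun _n _K _ q X h8 T hT horb ρ _ hρX hρs =>
    stub_altFixing_orbit_dichotomy q X h8 T hT horb ρ hρX hρs

end Summit.ValiantsHypothesis.ValiantsHypothesis.Theorems
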